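import Mathlib
import Literature.Probability.LatticeModels.IsingThermodynamics
import Literature.Probability.LatticeModels.LatticeLaplacianZd
import Summits.CriticalPhenomena.Ising3DConformalLimit.Theses.PerfectScreening

/-!
# Sketch — first lemmas of three crux ideas for `SubharmonicOffOrigin` (stmt-CriticalPhenomena-1341)

Planner crux-ideate seat `cruxidea-stmt-CriticalPhenomena-1341-3`, round 1. Each `def … : Prop` /
`theorem` below is the FIRST CHECKABLE STATEMENT of one idea card; nothing here is a proof of the
crux. `G := criticalTwoPoint 3`, `Δ := latticeLaplacianZd`, SubH ⟺ `∀ x ≠ 0, 0 ≤ Δ G x`.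
-/

namespace Summit.CriticalPhenomena.Ising3DConformalLimit.Cruxes.SubharmonicOffOrigin.Sketch3

open Literature.Probability.LatticeModels MeasureTheory Finset

noncomputable section

abbrev G : Site 3 → ℝ := criticalTwoPoint 3

/-- SubH restated through the tree's Laplacian (refuter rattack-1341 proved the equivalence). -/
theorem subH_iff :
    Summit.CriticalPhenomena.Ising3DConformalLimit.Theses.PerfectScreening.SubharmonicOffOrigin ↔
      ∀ x : Site 3, x ≠ 0 → 0 ≤ latticeLaplacianZd (criticalTwoPoint 3) x := by
  unfold Summit.CriticalPhenomena.Ising3DConformalLimit.Theses.PerfectScreening.SubharmonicOffOrigin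
  refine forall_congr' fun x => imp_congr_right fun _ => ?_
  rw [latticeLaplacianZd_nonneg_iff]
  norm_num

/-! ## Card A — `sdp-bracket-certificate`: near field on a β-bracket, no β_c needed -/

/-- Near-field SubH for the PLUS state at every β of a bracket `[βlo, βhi]`, on the sup-norm ball of
radius `R` minus the origin: the shape a β-parametric LP/SDP dual certificate certifies. -/
def NearFieldOnBracket (βlo βhi : ℝ) (R : ℕ) : Prop :=
  ∀ β ∈ Set.Icc βlo βhi, ∀ x : Site 3, x ≠ 0 → (∀ i, |x i| ≤ R) →
    0 ≤ latticeLaplacianZd (twoPointPlus 3 β) x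

/-- Far-field complement with the SAME explicit radius (the robust, sign-stable half). -/
def FarField (R : ℕ) : Prop :=
  ∀ x : Site 3, (∃ i, (R : ℤ) < |x i|) → 0 ≤ latticeLaplacianZd (criticalTwoPoint 3) x

/-- First lemma of card A (pure glue, proved): a bracket certificate plus ANY rigorous bracket
`βlo ≤ β_c(3) ≤ βhi` gives critical near-field SubH — the certificate never needs to locate β_c. -/
theorem nearField_critical_of_bracket {βlo βhi : ℝ} {R : ℕ}
    (h : NearFieldOnBracket βlo βhi R) (hlo : βlo ≤ criticalBeta 3) (hhi : criticalBeta 3 ≤ βhi) :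
    ∀ x : Site 3, x ≠ 0 → (∀ i, |x i| ≤ R) → 0 ≤ latticeLaplacianZd (criticalTwoPoint 3) x :=
  fun x hx hR => h (criticalBeta 3) ⟨hlo, hhi⟩ x hx hR

/-- Composition (proved): near field up to `R` + far field beyond `R` = SubH. -/
theorem subH_of_near_far {βlo βhi : ℝ} {R : ℕ}
    (h : NearFieldOnBracket βlo βhi R) (hlo : βlo ≤ criticalBeta 3) (hhi : criticalBeta 3 ≤ βhi)
    (hfar : FarField R) :
    ∀ x : Site 3, x ≠ 0 → 0 ≤ latticeLaplacianZd (criticalTwoPoint 3) x := by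
  intro x hx
  by_cases hin : ∀ i, |x i| ≤ R
  · exact nearField_critical_of_bracket h hlo hhi x hx hin
  · simp only [not_forall, not_le] at hin
    obtain ⟨i, hi⟩ := hin
    exact hfar x ⟨i, hi⟩

/-! ## Card B — `inverse-m-long-jump`: precision-kernel positivity ⇒ first shell, long-jump form -/

/-- The infinite-volume DIRECT-CORRELATION (precision) data of `G`: a symmetric kernel `a ≥ 0` off
the origin (conjecture IM, crux stmt-4798 `InverseMFerromagnet` via support `InverseMCriticalKernel`
of route PrecisionLaplacian), diagonal `A₀`, killing `m ≥ 0`, with the row identity of `G⁻¹ G = δ`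
off the origin. Finitely supported truncations suffice for the first-shell lemma, so `a` is taken
summable. -/
structure PrecisionData where
  a : Site 3 → ℝ
  A₀ : ℝ
  m : ℝ
  a_nonneg : ∀ y, y ≠ 0 → 0 ≤ a y
  a_zero : a 0 = 0
  a_symm : ∀ y, a (-y) = a y
  m_nonneg : 0 ≤ m
  summable : Summable a
  row : ∑' y, a y = A₀ - m
  harmonic : ∀ x : Site 3, x ≠ 0 → A₀ * G x = ∑' y, a y * G (x - y)

/-- First lemma of card B (the exact LONG-JUMP IDENTITY, to be proved from `PrecisionData`):
`a(e₁) · ΔG(x) = m·G(x) + Σ_{y not 0, not a unit vector} a(y) (G x − G (x − y))` for `x ≠ 0`. -/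
def LongJumpIdentity (P : PrecisionData) : Prop :=
  ∀ x : Site 3, x ≠ 0 →
    P.a (Pi.single 0 1) * latticeLaplacianZd G x =
      P.m * G x + ∑' y, (if (y = 0 ∨ ∃ i : Fin 3, y = Pi.single i 1 ∨ y = -Pi.single i 1) then 0
        else P.a y * (G x - G (x - y)))

/-- First-shell corollary (the razor-thin site, to be proved): IM-data + `a(e₁) > 0` + the
Messager–Miracle-Solé/Schrader bound `G z ≤ G e₁ (z ≠ 0)` (tree: `twoPointPlus_le_axis_of_mem_sphere`
+ axis antitonicity) ⇒ `ΔG(e₁) ≥ 0`, every summand being nonnegative. -/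
def FirstShellFromIM : Prop :=
  ∀ P : PrecisionData, LongJumpIdentity P → 0 < P.a (Pi.single 0 1) →
    (∀ z : Site 3, z ≠ 0 → G z ≤ G (Pi.single 0 1)) →
      0 ≤ latticeLaplacianZd G (Pi.single 0 1)

/-- Long-jump SUPERharmonicity (the transferred form of SubH at the remaining sites). -/
def LongJumpSuperharmonic (P : PrecisionData) : Prop :=
  ∀ x : Site 3, x ≠ 0 →
    ∑' y, (if (y = 0 ∨ ∃ i : Fin 3, y = Pi.single i 1 ∨ y = -Pi.single i 1) then 0
      else P.a y * (G (x + y) + G (x - y) - 2 * G x)) ≤ 0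

/-! ## Card C — `infrared-lightcone-abelian`: far field in mirror cones from the RP spectral measure -/

/-- A JOINT (λ, k) spectral measure of the critical two-point function in the `e₁` transfer
direction (Bochner upgrade of support `MixedSpectralRepresentation`, stmt-13893):
`G(n, x⊥) = ∫ λ^{|n|} cos(k·x⊥) dρ(λ,k)`, `ρ ≥ 0` finite on `[0,1] × [−π,π]²`. -/
def IsJointSpectralMeasure (ρ : Measure (ℝ × (Fin 2 → ℝ))) : Prop :=
  IsFiniteMeasure ρ ∧
  ρ (Set.Icc (0:ℝ) 1 ×ˢ Set.pi Set.univ (fun _ => Set.Icc (-Real.pi) Real.pi))ᶜ = 0 ∧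
  ∀ (n : ℤ) (x : Fin 2 → ℤ),
    G (Fin.cons n x) = ∫ p, p.1 ^ n.natAbs * Real.cos (∑ j, p.2 j * (x j : ℝ)) ∂ρ

/-- The Laplacian's SIGNED SPECTRAL WEIGHT `w(λ,k) = (1−λ)² − λ k̂²`, `k̂² = Σ_j 2(1 − cos k_j)`. -/
def lapWeight (p : ℝ × (Fin 2 → ℝ)) : ℝ :=
  (1 - p.1) ^ 2 - p.1 * ∑ j, 2 * (1 - Real.cos (p.2 j))

/-- Route identity (to be proved, measure theory): `ΔG(n,x⊥) = ∫ λ^{n−1} w(λ,k) cos(k·x⊥) dρ`, `n ≥ 1`. -/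
def LaplacianSpectralIdentity (ρ : Measure (ℝ × (Fin 2 → ℝ))) : Prop :=
  ∀ (n : ℕ) (x : Fin 2 → ℤ), 1 ≤ n →
    latticeLaplacianZd G (Fin.cons (n : ℤ) x) =
      ∫ p, p.1 ^ (n - 1) * lapWeight p * Real.cos (∑ j, p.2 j * (x j : ℝ)) ∂ρ

/-- TRANSVERSE-MOMENTUM GAP (qualitative infrared light cone): at every transverse momentum
bounded away from 0 the odd spectral weight is gapped, `ρ{λ > e^{−m(κ)}, |k| ≥ κ} = 0`. -/
def TransverseMomentumGap (ρ : Measure (ℝ × (Fin 2 → ℝ))) : Prop :=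
  ∀ κ : ℝ, 0 < κ → ∃ m : ℝ, 0 < m ∧ ρ {p | Real.exp (-m) < p.1 ∧ κ ≤ ‖p.2‖} = 0

/-- First lemma of card C (elementary, to be proved): under the gap, the large-`k` part of the
Laplacian's spectral integral is exponentially small in `n`, uniformly in `x⊥` — so the far-field
sign on the `e₁`-cone is decided by the corner `(λ,k) → (1,0)`, where `w > 0` iff `E > |k|`. -/
def LargeMomentumTailExpSmall (ρ : Measure (ℝ × (Fin 2 → ℝ))) : Prop :=
  IsJointSpectralMeasure ρ → TransverseMomentumGap ρ → ∀ κ : ℝ, 0 < κ → ∃ C m : ℝ, 0 < m ∧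
    ∀ (n : ℕ) (x : Fin 2 → ℤ), 1 ≤ n →
      |∫ p in {p | κ ≤ ‖p.2‖}, p.1 ^ (n - 1) * lapWeight p * Real.cos (∑ j, p.2 j * (x j : ℝ)) ∂ρ|
        ≤ C * Real.exp (-m * n)

/-- Eventual subharmonicity in the axial cone of aperture `θ` (conclusion shape of card C). -/
def EventuallySubharmonicInCone (θ : ℝ) : Prop :=
  ∃ N : ℕ, ∀ (n : ℕ) (x : Fin 2 → ℤ), N ≤ n → (∀ j, |(x j : ℝ)| ≤ θ * n) →
    0 ≤ latticeLaplacianZd G (Fin.cons (n : ℤ) x)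

end

end Summit.CriticalPhenomena.Ising3DConformalLimit.Cruxes.SubharmonicOffOrigin.Sketch3
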